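import Summits.BirchSwinnertonDyer.BirchSwinnertonDyer.Theorems.SchneiderFreeAdditiveX3LocalTowerTorsionLine
import Summits.BirchSwinnertonDyer.BirchSwinnertonDyer.Theorems.SchneiderFreeAdditiveX3LocalTowerTorsionWeight
import Summits.BirchSwinnertonDyer.Rank1Residual.X11b.AnticyclotomicEmbedding
import Summits.BirchSwinnertonDyer.Rank1Residual.Additive.SharpenedStatements
import Summits.Ventures.HodgeRepro2.T5DegreeOneNumberField
import Literature.NumberTheory.EllipticCurves.AnticyclotomicPrimeDecomposition
import HarnessLib

/-!
# Fin_v on the door's cells from the canonical line WITH ITS CHARACTER and the local norm residue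
# symbol of `π²/p^h` (crux `LocalTowerTorsionFiniteX3`, stmt-BirchSwinnertonDyer-19546)

Seat `bsd-schneider-door-c5` (cell `bsd-schneider-ideate`), gen 5; route `SchneiderFreeAdditiveX3`.
Third file of the Fin_v chain, after `…LocalTowerTorsionLine` (tower torsion ⊆ canonical line; Fin_v
from ONE moving element) and `…LocalTowerTorsionWeight` (no relation `± α^h φ(π)² = p^{2h}`).  The
moving element is SUPPLIED by the Literature fact
`ZpExtension.exists_isFrobPow_mem_kerSubgroup_of_isAnticyclotomic` (Tate VII §6 + Serre LCFT §2–3): the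
norm residue symbol `σ₀` of `π²/p^h` (`𝔭^h = (π)`) fixes every anticyclotomic tower, has Frobenius
degree `h` and cyclotomic character `p^{2h}/π²`.  The line is taken WITH ITS CHARACTER: a `D_𝔭`-stable
`C ≤ E(K̄)[p^∞]` with one cyclic layer and points of every order, an element of `D_𝔭` acting as `−1`
modulo `C`, and elements of Frobenius degree `n` acting on `C` by `± ε · α^{−n}`, `α` a unit root of
`X² − aX + p` (the unit root of the good ordinary twist on (G-ord, `e = 2`); `a = p+1`, `α = 1` on (M)).

* §1 degree one at a split prime in `ℤ`-vocabulary; a principal power `𝔭^h = (π)` (class group);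
* §2 `mul_sq_eq_of_congruences` — clause (iii) of the fact read `p`-adically through the `𝔭`-adic
  embedding `𝓞_K → ℤ_p` (`Summits/Ventures/HodgeRepro2/T5DegreeOneNumberField`):
  `ε(σ₀)·φ(π)² = p^{2h}`;
* §3 `localTowerTorsionFiniteAt_of_lineCharacter` — Fin_v at one frame: if `σ₀` fixed `C`, reading it
  on points of every order gives `± ε(σ₀) = α^h`, so `± α^h φ(π)² = p^{2h}` — excluded by the weight;
* §4 the two REGISTERED stubs (skeleton «by cell» 77a2917f) CONDITIONALLY, signatures verbatim:
  `stub_finV_gordTwo_of_lineCharacter`, `stub_finV_potMult_of_lineCharacter`.  Their line hypothesis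
  is the F2-class residue: on (G-ord, `e = 2`) the tree's ramified ordinary line (n1011
  `IsRamifiedOrdinaryLine`, from the `p*`-twist good model) transported to `(K, 𝔭)` + the unit-root
  Frobenius action on `Ẽ♭[p^∞]`; on (M) the Tate line (A40/A41) with character `±ε`.

Proofs only (no definition, no named fact, no `sorry`); helper for stmt-BirchSwinnertonDyer-19546;
closes nothing by itself; BSD is not advanced.  References: [JetchevSkinnerWan2017] §3.3 Prop. 3.3.4
Case 3(b); [CasselsFrohlichANT1967] Ch. VII §6, §10; [SerreLCFT1967] §2.5, §3.1; [GreenbergLNM1716] §2–3.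
-/

noncomputable section

open scoped Classical nonZeroDivisors

namespace Summit.BirchSwinnertonDyer.BirchSwinnertonDyer.Theorems.SchneiderFreeAdditiveX3

open NumberField IsDedekindDomain Field WeierstrassCurve
  Literature.NumberTheory.EllipticCurves Literature.NumberTheory.EllipticCurves.GreenbergSelmer
  Literature.NumberTheory.GaloisRepresentations
  Summit.BirchSwinnertonDyer.Rank1Residual.X11b
  Summit.Ventures.HodgeRepro2.T5DegreeOneNumberField

set_option linter.dupNamespace false

/-! ## §1. Degree one at a split prime; a principal power of `𝔭` -/

section DegreeOne

variable {K : Type} [Field K] [NumberField K] {p : ℕ} [hp : Fact p.Prime]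

omit [NumberField K] in
/-- A prime `𝔭 ∋ p` of `𝓞_K` lies over `(p) ⊆ ℤ`. [folklore] -/
theorem liesOver_span_of_natCast_mem {𝔭 : HeightOneSpectrum (𝓞 K)}
    (h𝔭 : ((p : ℕ) : 𝓞 K) ∈ 𝔭.asIdeal) : 𝔭.asIdeal.LiesOver (Ideal.span {(p : ℤ)}) := by
  refine ⟨?_⟩
  have hmax : (Ideal.span {(p : ℤ)}).IsMaximal :=
    PrincipalIdealRing.isMaximal_of_irreducible (Int.prime_iff_natAbs_prime.mpr
      (by simpa using hp.out)).irreducible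
  refine (hmax.eq_of_le ?_ ?_).symm ▸ rfl
  · exact Ideal.IsPrime.ne_top inferInstance
  · rw [Ideal.span_le, Set.singleton_subset_iff]
    change algebraMap ℤ (𝓞 K) (p : ℤ) ∈ 𝔭.asIdeal
    rw [map_natCast]
    exact h𝔭

/-- **Split primes have degree one in Mathlib's `ℤ`-vocabulary**: for `[K:ℚ] = 2` and `p` split in
`K` (`SplitsIn K p`: two primes of `𝓞_K` over `(p)`), every prime `𝔭 ∋ p` has
`e(𝔭|p)·f(𝔭|p) = 1` (fundamental identity `#{𝔭 | p}·e·f = [K:ℚ] = 2` for the Galois extension `K/ℚ`).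
[folklore] -/
theorem ramificationIdx_mul_inertiaDeg_eq_one_of_splitsIn (h2 : Module.finrank ℚ K = 2)
    (hs : SplitsIn K p) {𝔭 : HeightOneSpectrum (𝓞 K)} (h𝔭 : ((p : ℕ) : 𝓞 K) ∈ 𝔭.asIdeal) :
    𝔭.asIdeal.ramificationIdx ℤ * 𝔭.asIdeal.inertiaDeg ℤ = 1 := by
  haveI : Algebra.IsQuadraticExtension ℚ K := ⟨h2⟩
  haveI := liesOver_span_of_natCast_mem (K := K) h𝔭
  haveI : (Ideal.span {(p : ℤ)}).IsPrime :=
    (Ideal.span_singleton_prime (by exact_mod_cast hp.out.ne_zero)).mpr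
      (Int.prime_iff_natAbs_prime.mpr (by simpa using hp.out))
  set G := K ≃ₐ[ℚ] K
  have hG : Nat.card G = 2 := by rw [IsGalois.card_aut_eq_finrank, h2]
  have hid := Ideal.ncard_primesOver_mul_ramificationIdxIn_mul_inertiaDegIn
    (Ideal.span {(p : ℤ)}) (𝓞 K) G
  rw [hG] at hid
  unfold SplitsIn at hs
  rw [hs] at hid
  rw [← Ideal.ramificationIdxIn_eq_ramificationIdx (Ideal.span {(p : ℤ)}) 𝔭.asIdeal G,
    ← Ideal.inertiaDegIn_eq_inertiaDeg (Ideal.span {(p : ℤ)}) 𝔭.asIdeal G]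
  omega

/-- **A principal power of `𝔭`**: some `𝔭^h`, `h ≥ 1`, is principal (the class of `𝔭` in the finite
group `Cl(K)` has finite order). [folklore] -/
theorem exists_pow_eq_span_singleton (𝔭 : HeightOneSpectrum (𝓞 K)) :
    ∃ (h : ℕ) (π : 𝓞 K), 0 < h ∧ 𝔭.asIdeal ^ h = Ideal.span {π} := by
  have hI : 𝔭.asIdeal ∈ (Ideal (𝓞 K))⁰ := mem_nonZeroDivisors_iff_ne_zero.mpr 𝔭.ne_bot
  set c := ClassGroup.mk0 ⟨𝔭.asIdeal, hI⟩ with hc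
  refine ⟨orderOf c, ?_⟩
  have hpow : ClassGroup.mk0 ⟨𝔭.asIdeal ^ orderOf c, pow_mem hI _⟩ = 1 := by
    have : (⟨𝔭.asIdeal ^ orderOf c, pow_mem hI _⟩ : (Ideal (𝓞 K))⁰) = ⟨𝔭.asIdeal, hI⟩ ^ orderOf c :=
      rfl
    rw [this, map_pow, ← hc, pow_orderOf_eq_one]
  obtain ⟨π, hπ⟩ := ((ClassGroup.mk0_eq_one_iff _).mp hpow)
  exact ⟨π, orderOf_pos c, by rw [hπ]⟩

end DegreeOne

/-! ## §2. Clause (iii) of the fact read `p`-adically: `ε(σ₀) · φ(π)² = p^{2h}` -/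

section Padic

variable {K : Type} [Field K] [NumberField K] {p : ℕ} [hp : Fact p.Prime]
  (𝔭 : HeightOneSpectrum (𝓞 K)) [𝔭.asIdeal.LiesOver (Ideal.span {(p : ℤ)})]
  (hdeg : 𝔭.asIdeal.ramificationIdx ℤ * 𝔭.asIdeal.inertiaDeg ℤ = 1)

/-- `x ∈ 𝔭ⁿ ↔ φ x ∈ pⁿ ℤ_p` for the `𝔭`-adic embedding `φ : 𝓞_K → ℤ_p` (degree one). [folklore] -/
theorem mem_pow_iff_integersToPadicInt_mem_span (n : ℕ) (x : 𝓞 K) :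
    x ∈ 𝔭.asIdeal ^ n ↔
      integersToPadicInt 𝔭 p hdeg x ∈ (Ideal.span {(p : ℤ_[p]) ^ n} : Ideal ℤ_[p]) := by
  rw [mem_pow_iff_norm_le 𝔭 p hdeg, PadicInt.norm_le_pow_iff_mem_span_pow]

/-- The `𝔭`-adic embedding sends a generator `π` of `𝔭^h` to `u · p^h` with `u ∈ ℤ_pˣ`. [folklore] -/
theorem exists_unit_integersToPadicInt_eq {h : ℕ} {π : 𝓞 K}
    (hπ : 𝔭.asIdeal ^ h = Ideal.span {π}) :
    ∃ u : ℤ_[p]ˣ, integersToPadicInt 𝔭 p hdeg π = (u : ℤ_[p]) * (p : ℤ_[p]) ^ h := by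
  set φ := integersToPadicInt 𝔭 p hdeg with hφ
  have hπmem : π ∈ 𝔭.asIdeal ^ h := by rw [hπ]; exact Ideal.mem_span_singleton_self π
  have hπ0 : π ≠ 0 := by
    intro h0
    have : 𝔭.asIdeal ^ h = ⊥ := by rw [hπ, h0, Ideal.span_singleton_eq_bot]
    exact pow_ne_zero h 𝔭.ne_bot this
  have hφπ0 : φ π ≠ 0 := fun h0 ↦ hπ0 (integersToPadicInt_injective 𝔭 p hdeg (by rw [h0, map_zero]))
  -- valuation of `φ π` is exactly `h`
  have hle : h ≤ (φ π).valuation :=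
    (PadicInt.mem_span_pow_iff_le_valuation _ hφπ0 h).mp
      ((mem_pow_iff_integersToPadicInt_mem_span 𝔭 hdeg h π).mp hπmem)
  have hnot : ¬ (h + 1) ≤ (φ π).valuation := by
    intro hle'
    have hmem : π ∈ 𝔭.asIdeal ^ (h + 1) :=
      (mem_pow_iff_integersToPadicInt_mem_span 𝔭 hdeg (h + 1) π).mpr
        ((PadicInt.mem_span_pow_iff_le_valuation _ hφπ0 (h + 1)).mpr hle')
    have hlt : 𝔭.asIdeal ^ (h + 1) < 𝔭.asIdeal ^ h :=
      Ideal.pow_right_strictAnti 𝔭.asIdeal 𝔭.ne_bot 𝔭.isPrime.ne_top (Nat.lt_succ_self h)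
    have hle2 : 𝔭.asIdeal ^ h ≤ 𝔭.asIdeal ^ (h + 1) := by
      rw [hπ, Ideal.span_le, Set.singleton_subset_iff]; exact hmem
    exact absurd hle2 (not_le_of_gt hlt)
  have hval : (φ π).valuation = h := by omega
  refine ⟨PadicInt.unitCoeff hφπ0, ?_⟩
  have := PadicInt.unitCoeff_spec hφπ0
  rw [hval] at this
  exact this

/-- **Clause (iii) read `p`-adically.** If an element `ε ∈ ℤ_p` satisfies
`ε ≡ m (mod pⁿ)` whenever `m·π² ≡ p^{2h} (mod 𝔭^{n+2h})` (`m ∈ ℕ`) — the shape of clause (iii) of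
`ZpExtension.exists_isFrobPow_mem_kerSubgroup_of_isAnticyclotomic` for the cyclotomic character of
`σ₀` — then `ε · φ(π)² = p^{2h}` for the `𝔭`-adic embedding `φ` (`𝔭^h = (π)`, degree one).
[folklore] -/
theorem mul_sq_eq_of_congruences {h : ℕ} {π : 𝓞 K} (hπ : 𝔭.asIdeal ^ h = Ideal.span {π})
    {ε : ℤ_[p]}
    (hε : ∀ n m : ℕ, (m : 𝓞 K) * π ^ 2 - (p : 𝓞 K) ^ (2 * h) ∈ 𝔭.asIdeal ^ (n + 2 * h) →
      PadicInt.toZModPow n ε = (m : ZMod (p ^ n))) :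
    ε * (integersToPadicInt 𝔭 p hdeg π) ^ 2 = (p : ℤ_[p]) ^ (2 * h) := by
  set φ := integersToPadicInt 𝔭 p hdeg with hφ
  obtain ⟨u, hu⟩ := exists_unit_integersToPadicInt_eq (p := p) 𝔭 hdeg hπ
  set w : ℤ_[p] := ((u⁻¹ : ℤ_[p]ˣ) : ℤ_[p]) ^ 2 with hw
  have hwu : w * (u : ℤ_[p]) ^ 2 = 1 := by
    rw [hw, ← mul_pow, Units.inv_mul, one_pow]
  -- `ε = w`: all reductions agree
  have hεw : ε = w := by
    refine (PadicInt.ext_of_toZModPow).mp fun n ↦ ?_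
    set m : ℕ := (PadicInt.toZModPow n w).val with hm
    have hmw : (m : ℤ_[p]) - w ∈ (Ideal.span {(p : ℤ_[p]) ^ n} : Ideal ℤ_[p]) := by
      rw [← PadicInt.ker_toZModPow, RingHom.mem_ker, map_sub, map_natCast, hm, ZMod.natCast_zmod_val,
        sub_self]
    obtain ⟨c, hc⟩ := Ideal.mem_span_singleton.mp hmw
    have hcong : (m : 𝓞 K) * π ^ 2 - (p : 𝓞 K) ^ (2 * h) ∈ 𝔭.asIdeal ^ (n + 2 * h) := by
      rw [mem_pow_iff_integersToPadicInt_mem_span (p := p) 𝔭 hdeg, map_sub, map_mul, map_natCast, map_pow,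
        map_pow, map_natCast, ← hφ, hu, Ideal.mem_span_singleton]
      refine ⟨(u : ℤ_[p]) ^ 2 * c, ?_⟩
      have key : (m : ℤ_[p]) * ((u : ℤ_[p]) * (p : ℤ_[p]) ^ h) ^ 2 - (p : ℤ_[p]) ^ (2 * h) =
          (p : ℤ_[p]) ^ (2 * h) * (u : ℤ_[p]) ^ 2 * ((m : ℤ_[p]) - w) := by
        linear_combination (p : ℤ_[p]) ^ (2 * h) * hwu
      rw [key, hc, pow_add]
      ring
    rw [hε n m hcong, hm, ZMod.natCast_zmod_val]
  rw [hεw, hu, mul_pow, ← pow_mul, mul_comm h 2, ← mul_assoc, hwu, one_mul]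

end Padic

/-! ## §3. Fin_v at one frame from the line-with-character and the norm residue symbol -/

section Frame

variable (W : WeierstrassCurve ℚ) [W.IsElliptic] {p : ℕ} [hp : Fact p.Prime]
  {K : Type} [Field K] [NumberField K]

/-- **Fin_v at one frame from the canonical line with its character.**  `W/ℚ` elliptic, `p` odd, `K`
imaginary quadratic with `p` split, `κ` an anticyclotomic `ℤ_p`-extension, `𝔭 ∣ p`.  Inputs: (CFT) the
fact `ZpExtension.exists_isFrobPow_mem_kerSubgroup_of_isAnticyclotomic K p`; (LINE) a `D_𝔭`-stable
`C ≤ E(K̄)[p^∞]` with `#C[p] ≤ p`, points of every order `p^k`, an element of `D_𝔭` acting as `−1`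
modulo `C`, and the CHARACTER of `C`: every `σ ∈ Γ_{K_𝔭}` of Frobenius degree `n` acts on `C` as
`s·ε(σ)·α^{−n}` (`s = ±1`, `α` a unit root of `X² − aX + p`).  Then `E(K̄)[p^∞]^{D_𝔭 ⊓ ker κ}` is finite.
Proof: by `localTowerTorsionFiniteAt_of_line` it suffices that the norm residue symbol `σ₀` of
`π²/p^h` (degree `h`, in `ker κ`, `ε(σ₀)φ(π)² = p^{2h}`) moves a point of `C`; if it fixed `C`, its
scalar `s ε(σ₀) α^{-h}` would be `≡ 1 (mod p^k)` for every `k` (points of order `p^k`), so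
`s α^h φ(π)² = p^{2h}` in `ℤ_p` — excluded by `ne_of_unitRoot_of_span_eq_pow`.
[cite: JetchevSkinnerWan2017, §3.3 Prop. 3.3.4 Case 3(b) (arXiv:1512.06894 p. 13)] -/
theorem localTowerTorsionFiniteAt_of_lineCharacter (hp2 : p ≠ 2) (hK : IsImaginaryQuadratic K)
    (hsplit : SplitsIn K p) (κ : ZpExtension K p) (hκ : κ.IsAnticyclotomic)
    (𝔭 : HeightOneSpectrum (𝓞 K)) (h𝔭 : ((p : ℕ) : 𝓞 K) ∈ 𝔭.asIdeal)
    (hCFT : ZpExtension.exists_isFrobPow_mem_kerSubgroup_of_isAnticyclotomic K p)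
    (C : AddSubgroup ((W.baseChange K).geomPrimaryTorsion p))
    (hCD : ∀ d ∈ decomp 𝔭, ∀ c ∈ C, d • c ∈ C)
    (hC1 : Set.ncard {c : (W.baseChange K).geomPrimaryTorsion p | c ∈ C ∧ p • c = 0} ≤ p)
    (hCord : ∀ k : ℕ, ∃ c ∈ C, addOrderOf c = p ^ k)
    (hτ : ∃ τ ∈ decomp 𝔭, ∀ m : (W.baseChange K).geomPrimaryTorsion p, τ • m + m ∈ C)
    (a : ℤ) (α : ℤ_[p]ˣ) (hα : ((α : ℤ_[p])) ^ 2 = a * (α : ℤ_[p]) - p)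
    (hchar : ∀ (σ : absoluteGaloisGroup (𝔭.adicCompletion K)) (n : ℕ), IsFrobPow σ (n : ℤ) →
      ∃ s : ℤ, (s = 1 ∨ s = -1) ∧
        ∀ (k : ℕ) (c : (W.baseChange K).geomPrimaryTorsion p), c ∈ C → p ^ k • c = 0 →
          ∀ N : ℤ, ((N : ℤ_[p]) - s *
              ((GaloisRep.cyclotomicCharacter K p (absGaloisRestrict K (𝔭.adicCompletion K) σ) *
                (α⁻¹) ^ n : ℤ_[p]ˣ) : ℤ_[p]) ∈ (Ideal.span {(p : ℤ_[p]) ^ k} : Ideal ℤ_[p])) →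
            absGaloisRestrict K (𝔭.adicCompletion K) σ • c = N • c) :
    SchneiderFreeControlAtoms.LocalTowerTorsionFiniteAt (W.baseChange K) p κ 𝔭 := by
  have h2 : Module.finrank ℚ K = 2 := hK.1
  obtain ⟨he, hf⟩ := degreeOne_of_splitsIn h2 hsplit h𝔭
  haveI := liesOver_span_of_natCast_mem (K := K) h𝔭
  have hdeg := ramificationIdx_mul_inertiaDeg_eq_one_of_splitsIn h2 hsplit h𝔭
  obtain ⟨h, π, hh, hπ⟩ := exists_pow_eq_span_singleton 𝔭
  obtain ⟨σ₀, hfrob, hker, hcyc⟩ := hCFT hK hp2 𝔭 h𝔭 he hf h π hh hπ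
  obtain ⟨τ, hτD, hτ'⟩ := hτ
  refine (W.baseChange K).localTowerTorsionFiniteAt_of_line κ 𝔭 hp2 C hτD
    (fun c hc ↦ hCD τ hτD c hc) hτ' hC1 ?_
  -- the moving element: `g = res σ₀`
  set g := absGaloisRestrict K (𝔭.adicCompletion K) σ₀ with hg
  refine ⟨g, Subgroup.mem_inf.mpr ⟨⟨σ₀, rfl⟩, hker κ hκ⟩, ?_⟩
  by_contra hfix
  push Not at hfix
  obtain ⟨s, hs1, hsc⟩ := hchar σ₀ h hfrob
  set εu : ℤ_[p]ˣ := GaloisRep.cyclotomicCharacter K p g with hεu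
  set u : ℤ_[p]ˣ := εu * (α⁻¹) ^ h with hu
  -- Step A: `s · u = 1` in `ℤ_p` (read off points of `C` of every order)
  have hsu : (s : ℤ_[p]) * (u : ℤ_[p]) = 1 := by
    refine (PadicInt.ext_of_toZModPow).mp fun k ↦ ?_
    obtain ⟨c, hcC, hcord⟩ := hCord k
    set N : ℕ := (PadicInt.toZModPow k ((s : ℤ_[p]) * (u : ℤ_[p]))).val with hN
    have hNmem : (((N : ℤ) : ℤ_[p])) - s * (u : ℤ_[p]) ∈
        (Ideal.span {(p : ℤ_[p]) ^ k} : Ideal ℤ_[p]) := by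
      rw [← PadicInt.ker_toZModPow, RingHom.mem_ker, map_sub, map_intCast, Int.cast_natCast, hN,
        ZMod.natCast_zmod_val, sub_self]
    have hpk : p ^ k • c = 0 := by rw [← hcord]; exact addOrderOf_nsmul_eq_zero c
    have h1 := hsc k c hcC hpk (N : ℤ) hNmem
    rw [hfix c hcC] at h1
    -- `c = N • c` with `c` of order `p^k`: `N ≡ 1 (mod p^k)`
    have hdvd : ((p ^ k : ℕ) : ℤ) ∣ (N : ℤ) - 1 := by
      rw [← hcord, addOrderOf_dvd_iff_zsmul_eq_zero]
      have e1 : ((N : ℤ) - 1) • c = (N : ℤ) • c - c := by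
        rw [sub_smul, one_smul]
      rw [e1, ← h1, sub_self]
    have hNone : ((N : ℤ) : ZMod (p ^ k)) = 1 := by
      rw [← Int.cast_one, ZMod.intCast_eq_intCast_iff_dvd_sub]
      rw [← Int.dvd_neg, neg_sub]
      exact hdvd
    rw [map_one, ← hNone, Int.cast_natCast, hN, ZMod.natCast_zmod_val]
  -- Step B: `ε(σ₀) φ(π)² = p^{2h}`
  have hB := mul_sq_eq_of_congruences (p := p) 𝔭 hdeg hπ hcyc
  -- Step C: `s α^h φ(π)² = p^{2h}` in `ℤ_p`, then in `ℚ_p`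
  set φ := integersToPadicInt 𝔭 p hdeg with hφ
  have hss : (s : ℤ_[p]) * s = 1 := by rcases hs1 with rfl | rfl <;> push_cast <;> norm_num
  have hC : (s : ℤ_[p]) * (α : ℤ_[p]) ^ h * φ π ^ 2 = (p : ℤ_[p]) ^ (2 * h) := by
    have hεα : (εu : ℤ_[p]) = s * (α : ℤ_[p]) ^ h := by
      have h1 : (s : ℤ_[p]) * (εu : ℤ_[p]) * ((α⁻¹ ^ h : ℤ_[p]ˣ) : ℤ_[p]) = 1 := by
        rw [mul_assoc, ← Units.val_mul, ← hu]; exact hsu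
      have h2 : ((α⁻¹ ^ h : ℤ_[p]ˣ) : ℤ_[p]) * (α : ℤ_[p]) ^ h = 1 := by
        rw [← Units.val_pow_eq_pow_val, ← Units.val_mul, ← mul_pow, inv_mul_cancel, one_pow,
          Units.val_one]
      calc (εu : ℤ_[p]) = (s * s) * (εu : ℤ_[p]) * (((α⁻¹ ^ h : ℤ_[p]ˣ) : ℤ_[p]) * (α : ℤ_[p]) ^ h) := by
              rw [hss, h2, one_mul, mul_one]
        _ = s * ((s : ℤ_[p]) * (εu : ℤ_[p]) * ((α⁻¹ ^ h : ℤ_[p]ˣ) : ℤ_[p])) * (α : ℤ_[p]) ^ h := by ring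
        _ = s * (α : ℤ_[p]) ^ h := by rw [h1, mul_one]
    rw [← hB, hεα, hφ]
  -- transport to the field `ℚ_p` and apply the weight obstruction
  have hN : Ideal.absNorm 𝔭.asIdeal = p := by
    rw [Ideal.absNorm_apply, Submodule.cardQuot_apply, ← pow_one 𝔭.asIdeal, natCard_quot_pow' 𝔭 p hdeg 1,
      pow_one]
  have hφ' : Function.Injective ((PadicInt.Coe.ringHom (p := p)).comp φ) :=
    (Subtype.val_injective).comp (integersToPadicInt_injective 𝔭 p hdeg)
  refine ne_of_unitRoot_of_span_eq_pow (R := ℚ_[p]) h2 𝔭.isPrime hp.out hN h𝔭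
    (natCast_notMem_sq 𝔭 p hdeg) hh hπ ((PadicInt.Coe.ringHom (p := p)).comp φ) hφ'
    (a := a) (α := ((α : ℤ_[p]) : ℚ_[p])) (by exact_mod_cast congrArg (fun z : ℤ_[p] ↦ (z : ℚ_[p])) hα)
    hs1 ?_
  have := congrArg (fun z : ℤ_[p] ↦ (z : ℚ_[p])) hC
  simpa using this

end Frame

/-! ## §4. The two registered stubs, conditionally on the line-with-character -/

section Stubs

/-- **Registered stub `stub_finV_gordTwo` of crux `LocalTowerTorsionFiniteX3`
(stmt-BirchSwinnertonDyer-19546), CONDITIONALLY** — signature verbatim, from (i) the fact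
`ZpExtension.exists_isFrobPow_mem_kerSubgroup_of_isAnticyclotomic` and (ii) the line with character on
the cell (G-ord, `e = 2`): `C = ψ ⊗ Ê♭[p^∞]` for the good ordinary `p*`-twist `E♭`, `α` its unit root, `ψ` the ramified quadratic character; (ii) is the F2-class residue of the stub.  [cite: JetchevSkinnerWan2017, §3.3 Prop. 3.3.4 Case 3(b), Remark 3.3.5 (arXiv:1512.06894 p. 13)] -/
theorem stub_finV_gordTwo_of_lineCharacter
    (hCFT : ∀ (K : Type) [Field K] [NumberField K] (p : ℕ) [Fact p.Prime],
      ZpExtension.exists_isFrobPow_mem_kerSubgroup_of_isAnticyclotomic K p)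
    (hLine : ∀ (W : WeierstrassCurve ℚ) [W.IsElliptic] [W.IsGloballyMinimal] (p : ℕ) [Fact p.Prime],
      W.analyticRank = 1 → p ≠ 2 → Literature.NumberTheory.EllipticCurves.Rank1Residual.ClassX3 W p →
        Summit.BirchSwinnertonDyer.Rank1Residual.Additive.SubGordTwo W p →
        ∀ (K : Type) [Field K] [NumberField K], IsImaginaryQuadratic K → SplitsIn K p →
          ∀ (𝔭 : HeightOneSpectrum (𝓞 K)), ((p : ℕ) : 𝓞 K) ∈ 𝔭.asIdeal →
          ∃ (C : AddSubgroup ((W.baseChange K).geomPrimaryTorsion p)) (a : ℤ) (α : ℤ_[p]ˣ),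
            (∀ d ∈ decomp 𝔭, ∀ c ∈ C, d • c ∈ C) ∧
            Set.ncard {c : (W.baseChange K).geomPrimaryTorsion p | c ∈ C ∧ p • c = 0} ≤ p ∧
            (∀ k : ℕ, ∃ c ∈ C, addOrderOf c = p ^ k) ∧
            (∃ τ ∈ decomp 𝔭, ∀ m : (W.baseChange K).geomPrimaryTorsion p, τ • m + m ∈ C) ∧
            ((α : ℤ_[p])) ^ 2 = a * (α : ℤ_[p]) - p ∧
            (∀ (σ : absoluteGaloisGroup (𝔭.adicCompletion K)) (n : ℕ), IsFrobPow σ (n : ℤ) →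
              ∃ s : ℤ, (s = 1 ∨ s = -1) ∧
                ∀ (k : ℕ) (c : (W.baseChange K).geomPrimaryTorsion p), c ∈ C → p ^ k • c = 0 →
                  ∀ N : ℤ, ((N : ℤ_[p]) - s *
                      ((GaloisRep.cyclotomicCharacter K p
                          (absGaloisRestrict K (𝔭.adicCompletion K) σ) * (α⁻¹) ^ n : ℤ_[p]ˣ) :
                        ℤ_[p]) ∈ (Ideal.span {(p : ℤ_[p]) ^ k} : Ideal ℤ_[p])) →
                    absGaloisRestrict K (𝔭.adicCompletion K) σ • c = N • c)) :
    ∀ (W : WeierstrassCurve ℚ) [W.IsElliptic] [W.IsGloballyMinimal] (p : ℕ) [Fact p.Prime],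
      W.analyticRank = 1 → p ≠ 2 → Literature.NumberTheory.EllipticCurves.Rank1Residual.ClassX3 W p →
        Summit.BirchSwinnertonDyer.Rank1Residual.Additive.SubGordTwo W p →
        (∀ (K : Type) [Field K] [NumberField K],
          Literature.NumberTheory.EllipticCurves.IsImaginaryQuadratic K →
          Summit.BirchSwinnertonDyer.Rank1Residual.X11b.SplitsIn K p →
          ∀ (κ : Literature.NumberTheory.EllipticCurves.ZpExtension K p), κ.IsAnticyclotomic →
          ∀ (𝔭 : IsDedekindDomain.HeightOneSpectrum (NumberField.RingOfIntegers K)),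
            ((p : ℕ) : NumberField.RingOfIntegers K) ∈ 𝔭.asIdeal →
            (FixedPoints.addSubgroup ↥(Literature.NumberTheory.EllipticCurves.GreenbergSelmer.decomp 𝔭 ⊓
              κ.kerSubgroup) ((W.baseChange K).geomPrimaryTorsion p) :
            Set ((W.baseChange K).geomPrimaryTorsion p)).Finite) := by
  intro W _ _ p _ hr hp2 hX hcell K _ _ hK hsplit κ hκ 𝔭 h𝔭
  obtain ⟨C, a, α, hCD, hC1, hCord, hτ, hα, hchar⟩ := hLine W p hr hp2 hX hcell K hK hsplit 𝔭 h𝔭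
  exact localTowerTorsionFiniteAt_of_lineCharacter W hp2 hK hsplit κ hκ 𝔭 h𝔭 (hCFT K p) C hCD hC1
    hCord hτ a α hα hchar

/-- **Registered stub `stub_finV_potMult` of crux `LocalTowerTorsionFiniteX3`
(stmt-BirchSwinnertonDyer-19546), CONDITIONALLY** — signature verbatim, from (i) the fact
`ZpExtension.exists_isFrobPow_mem_kerSubgroup_of_isAnticyclotomic` and (ii) the line with character on
the cell (M): `C` the Tate line of the multiplicative twist, character `±ε`, i.e. `a = p + 1`, `α = 1`; (ii) is the F2-class residue of the stub.  [cite: JetchevSkinnerWan2017, §3.3 Prop. 3.3.4 Case 3(b), Remark 3.3.5 (arXiv:1512.06894 p. 13)] -/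
theorem stub_finV_potMult_of_lineCharacter
    (hCFT : ∀ (K : Type) [Field K] [NumberField K] (p : ℕ) [Fact p.Prime],
      ZpExtension.exists_isFrobPow_mem_kerSubgroup_of_isAnticyclotomic K p)
    (hLine : ∀ (W : WeierstrassCurve ℚ) [W.IsElliptic] [W.IsGloballyMinimal] (p : ℕ) [Fact p.Prime],
      W.analyticRank = 1 → p ≠ 2 → Literature.NumberTheory.EllipticCurves.Rank1Residual.ClassX3 W p →
        Summit.BirchSwinnertonDyer.Rank1Residual.Additive.SubM W p →
        ∀ (K : Type) [Field K] [NumberField K], IsImaginaryQuadratic K → SplitsIn K p →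
          ∀ (𝔭 : HeightOneSpectrum (𝓞 K)), ((p : ℕ) : 𝓞 K) ∈ 𝔭.asIdeal →
          ∃ (C : AddSubgroup ((W.baseChange K).geomPrimaryTorsion p)) (a : ℤ) (α : ℤ_[p]ˣ),
            (∀ d ∈ decomp 𝔭, ∀ c ∈ C, d • c ∈ C) ∧
            Set.ncard {c : (W.baseChange K).geomPrimaryTorsion p | c ∈ C ∧ p • c = 0} ≤ p ∧
            (∀ k : ℕ, ∃ c ∈ C, addOrderOf c = p ^ k) ∧
            (∃ τ ∈ decomp 𝔭, ∀ m : (W.baseChange K).geomPrimaryTorsion p, τ • m + m ∈ C) ∧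
            ((α : ℤ_[p])) ^ 2 = a * (α : ℤ_[p]) - p ∧
            (∀ (σ : absoluteGaloisGroup (𝔭.adicCompletion K)) (n : ℕ), IsFrobPow σ (n : ℤ) →
              ∃ s : ℤ, (s = 1 ∨ s = -1) ∧
                ∀ (k : ℕ) (c : (W.baseChange K).geomPrimaryTorsion p), c ∈ C → p ^ k • c = 0 →
                  ∀ N : ℤ, ((N : ℤ_[p]) - s *
                      ((GaloisRep.cyclotomicCharacter K p
                          (absGaloisRestrict K (𝔭.adicCompletion K) σ) * (α⁻¹) ^ n : ℤ_[p]ˣ) :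
                        ℤ_[p]) ∈ (Ideal.span {(p : ℤ_[p]) ^ k} : Ideal ℤ_[p])) →
                    absGaloisRestrict K (𝔭.adicCompletion K) σ • c = N • c)) :
    ∀ (W : WeierstrassCurve ℚ) [W.IsElliptic] [W.IsGloballyMinimal] (p : ℕ) [Fact p.Prime],
      W.analyticRank = 1 → p ≠ 2 → Literature.NumberTheory.EllipticCurves.Rank1Residual.ClassX3 W p →
        Summit.BirchSwinnertonDyer.Rank1Residual.Additive.SubM W p →
        (∀ (K : Type) [Field K] [NumberField K],
          Literature.NumberTheory.EllipticCurves.IsImaginaryQuadratic K →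
          Summit.BirchSwinnertonDyer.Rank1Residual.X11b.SplitsIn K p →
          ∀ (κ : Literature.NumberTheory.EllipticCurves.ZpExtension K p), κ.IsAnticyclotomic →
          ∀ (𝔭 : IsDedekindDomain.HeightOneSpectrum (NumberField.RingOfIntegers K)),
            ((p : ℕ) : NumberField.RingOfIntegers K) ∈ 𝔭.asIdeal →
            (FixedPoints.addSubgroup ↥(Literature.NumberTheory.EllipticCurves.GreenbergSelmer.decomp 𝔭 ⊓
              κ.kerSubgroup) ((W.baseChange K).geomPrimaryTorsion p) :
            Set ((W.baseChange K).geomPrimaryTorsion p)).Finite) := by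
  intro W _ _ p _ hr hp2 hX hcell K _ _ hK hsplit κ hκ 𝔭 h𝔭
  obtain ⟨C, a, α, hCD, hC1, hCord, hτ, hα, hchar⟩ := hLine W p hr hp2 hX hcell K hK hsplit 𝔭 h𝔭
  exact localTowerTorsionFiniteAt_of_lineCharacter W hp2 hK hsplit κ hκ 𝔭 h𝔭 (hCFT K p) C hCD hC1
    hCord hτ a α hα hchar

end Stubs

end Summit.BirchSwinnertonDyer.BirchSwinnertonDyer.Theorems.SchneiderFreeAdditiveX3

end
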